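import Literature.NumberTheory.LFunctions.MoebiusCharSumLinnikBox
import Literature.NumberTheory.LFunctions.LiouvilleCoprimeSum
import Literature.NumberTheory.LFunctions.SiegelWalfiszLiouville
import HarnessLib

/-!
# Character sums of the Liouville function from a zero-free Linnik box

Topic `Literature/NumberTheory/LFunctions`. Everything in this file is PROVED.

**Theorem** (`LiouvilleCharSumLinnikBox.norm_sum_le`). For every real `B` there are `K', H, x₀`
such that for `x ≥ x₀`, `L = log x`, every modulus `q ≤ x^{1/16}`, every Dirichlet character `χ`
mod `q` (principal or not) whose `L(s, χ)` has no zero `s ≠ 1` with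
`Re s > 1 − K' log L/L`, `|Im s| ≤ L^H`, and every `x^{1/2} ≤ y ≤ x²`:

`‖∑_{k ≤ y} λ(k) χ(k)‖ ≤ y / L^B`.

For `χ ≠ χ₀` this is the Möbius statement of `MoebiusCharSumLinnikBox.lean` transported through
`λ = 𝟙_□ ⋆ μ` (`∑_{k ≤ N} λ(k)χ(k) = ∑_{r² ≤ N} χ(r)² M(N/r², χ)`, `sum_liouville_twist_eq`, the
bookkeeping of `SiegelWalfiszLiouville.lean` with the weight `χ`), splitting at `r ≈ L^{B+1}`;
for `χ = χ₀` it is the coprimality-restricted prime number theorem for `λ`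
(`LiouvilleCoprimeSum.lean`), where no `L`-function input is needed. This is the "one-point
information bought by genericity" in Linnik-type arguments (Iwaniec–Kowalski §18.2).

## References

* [IwaniecKowalski2004] H. Iwaniec, E. Kowalski, *Analytic Number Theory*, AMS 2004, §18.2.
* [MontgomeryVaughan2007] H. L. Montgomery, R. C. Vaughan, *Multiplicative Number Theory I*,
  CUP 2007, §11.3 Exercise 8.
-/

noncomputable section

open Finset ArithmeticFunction
open scoped ArithmeticFunction.Moebius

namespace Literature.NumberTheory.LFunctions

namespace LiouvilleCharSumLinnikBox

variable {q : ℕ}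

/-- `λ(n) = ∑_{sm = n} 𝟙_□(s) μ(m)` in `ℂ`. [folklore] -/
theorem liouville_eq_sum_antidiagonal_complex (n : ℕ) :
    (liouville n : ℂ) =
      ∑ x ∈ n.divisorsAntidiagonal, (if IsSquare x.1 then (1 : ℂ) else 0) * (μ x.2 : ℂ) := by
  have h := SiegelWalfiszLiouville.liouville_eq_sum_antidiagonal n
  have h2 : ((liouville n : ℝ) : ℂ) = ((∑ x ∈ n.divisorsAntidiagonal,
      (if IsSquare x.1 then (1 : ℝ) else 0) * (μ x.2 : ℝ) : ℝ) : ℂ) := by rw [h]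
  rw [Complex.ofReal_intCast, Complex.ofReal_sum] at h2
  rw [h2]
  refine sum_congr rfl fun x _ ↦ ?_
  rw [Complex.ofReal_mul, Complex.ofReal_intCast]
  split_ifs <;> simp

/-- **`∑_{k ≤ N} λ(k)χ(k) = ∑_{s ≤ N} 𝟙_□(s) χ(s) ∑_{m ≤ N/s} χ(m)μ(m)`** (`λ = 𝟙_□ ⋆ μ` and complete
multiplicativity of `χ`). [folklore] -/
theorem sum_liouville_twist_eq (χ : DirichletCharacter ℂ q) (N : ℕ) :
    ∑ k ∈ Icc 1 N, (liouville k : ℂ) * χ (k : ZMod q) =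
      ∑ s ∈ Ioc 0 N, (if IsSquare s then (1 : ℂ) else 0) * χ (s : ZMod q) *
        ∑ m ∈ Ioc 0 (N / s), χ (m : ZMod q) * (μ m : ℂ) := by
  have hIcc : Icc 1 N = Ioc 0 N := rfl
  calc ∑ k ∈ Icc 1 N, (liouville k : ℂ) * χ (k : ZMod q)
      = ∑ k ∈ Ioc 0 N, ∑ x ∈ k.divisorsAntidiagonal,
          (if IsSquare x.1 then (1 : ℂ) else 0) * (μ x.2 : ℂ) * χ ((x.1 * x.2 : ℕ) : ZMod q) := by
        rw [hIcc]
        refine sum_congr rfl fun k _ ↦ ?_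
        rw [liouville_eq_sum_antidiagonal_complex k, sum_mul]
        refine sum_congr rfl fun x hx ↦ ?_
        rw [Nat.mem_divisorsAntidiagonal] at hx
        rw [hx.1]
    _ = ∑ s ∈ Ioc 0 N, ∑ m ∈ Ioc 0 (N / s),
          (if IsSquare s then (1 : ℂ) else 0) * (μ m : ℂ) * χ ((s * m : ℕ) : ZMod q) :=
        SiegelWalfiszLiouville.sum_Ioc_sum_divisorsAntidiagonal_eq
          (fun s m ↦ (if IsSquare s then (1 : ℂ) else 0) * (μ m : ℂ) * χ ((s * m : ℕ) : ZMod q)) N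
    _ = _ := by
        refine sum_congr rfl fun s _ ↦ ?_
        rw [mul_sum]
        refine sum_congr rfl fun m _ ↦ ?_
        rw [Nat.cast_mul, map_mul]; ring

/-- **`‖∑_{k ≤ N} λ(k)χ(k)‖ ≤ ∑_{r ≤ √N} ‖M(N/r², χ)‖`**, `M(n, χ) = ∑_{m ≤ n} χ(m)μ(m)`. [folklore] -/
theorem norm_sum_liouville_twist_le (χ : DirichletCharacter ℂ q) (N : ℕ) :
    ‖∑ k ∈ Icc 1 N, (liouville k : ℂ) * χ (k : ZMod q)‖ ≤
      ∑ r ∈ Ioc 0 (Nat.sqrt N), ‖∑ m ∈ Icc 1 (N / (r * r)), χ (m : ZMod q) * (μ m : ℂ)‖ := by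
  rw [sum_liouville_twist_eq]
  have hIoc : ∀ n : ℕ, Ioc 0 n = Icc 1 n := fun n ↦ rfl
  calc ‖∑ s ∈ Ioc 0 N, (if IsSquare s then (1 : ℂ) else 0) * χ (s : ZMod q) *
          ∑ m ∈ Ioc 0 (N / s), χ (m : ZMod q) * (μ m : ℂ)‖
      ≤ ∑ s ∈ Ioc 0 N, ‖(if IsSquare s then (1 : ℂ) else 0) * χ (s : ZMod q) *
          ∑ m ∈ Ioc 0 (N / s), χ (m : ZMod q) * (μ m : ℂ)‖ := norm_sum_le _ _
    _ ≤ ∑ s ∈ Ioc 0 N, (if IsSquare s then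
          ‖∑ m ∈ Icc 1 (N / s), χ (m : ZMod q) * (μ m : ℂ)‖ else 0) := by
        refine sum_le_sum fun s _ ↦ ?_
        split_ifs with h
        · rw [one_mul, norm_mul, hIoc]
          calc ‖χ (s : ZMod q)‖ * ‖∑ m ∈ Icc 1 (N / s), χ (m : ZMod q) * (μ m : ℂ)‖
              ≤ 1 * ‖∑ m ∈ Icc 1 (N / s), χ (m : ZMod q) * (μ m : ℂ)‖ :=
                mul_le_mul_of_nonneg_right (DirichletCharacter.norm_le_one χ _) (norm_nonneg _)
            _ = _ := one_mul _
        · simp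
    _ = ∑ s ∈ (Ioc 0 N).filter IsSquare, ‖∑ m ∈ Icc 1 (N / s), χ (m : ZMod q) * (μ m : ℂ)‖ :=
        (sum_filter _ _).symm
    _ = _ := by
        rw [SiegelWalfiszLiouville.filter_isSquare_Ioc_eq_image, sum_image]
        intro r₁ _ r₂ _ h
        exact Nat.mul_self_inj.mp h

/-- The trivial bound `‖M(n, χ)‖ ≤ n`. [folklore] -/
theorem norm_moebius_twist_sum_le (χ : DirichletCharacter ℂ q) (n : ℕ) :
    ‖∑ m ∈ Icc 1 n, χ (m : ZMod q) * (μ m : ℂ)‖ ≤ n := by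
  calc ‖∑ m ∈ Icc 1 n, χ (m : ZMod q) * (μ m : ℂ)‖ ≤ ∑ m ∈ Icc 1 n, ‖χ (m : ZMod q) * (μ m : ℂ)‖ :=
        norm_sum_le _ _
    _ ≤ ∑ _m ∈ Icc 1 n, (1 : ℝ) :=
        sum_le_sum fun m _ ↦ MoebiusCharSumLinnikBox.norm_twist_moebius_le χ m
    _ = n := by simp

/-- Bookkeeping: for `B ≥ 0`, `ℓ ≥ 80B + 100`, `L = e^ℓ`: `16 ≤ L` and
`3 (e^{(B+1)ℓ})² e^{2L/5} ≤ e^{L/2}` (i.e. `3 L^{2B+2} x^{2/5} ≤ x^{1/2}`). [folklore] -/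
theorem numerics₂ {B ℓ L : ℝ} (hB : 0 ≤ B) (hℓ : 80 * B + 100 ≤ ℓ) (hL : L = Real.exp ℓ) :
    16 ≤ L ∧ 3 * (Real.exp ((B + 1) * ℓ) * Real.exp ((B + 1) * ℓ)) * Real.exp (2 / 5 * L) ≤
      Real.exp (1 / 2 * L) := by
  have hL1 : ℓ + 1 ≤ L := by rw [hL]; exact Real.add_one_le_exp ℓ
  have hLsq : ℓ ^ 2 / 4 ≤ L := by
    have h := Real.add_one_le_exp (ℓ / 2)
    have h2 : Real.exp ℓ = Real.exp (ℓ / 2) * Real.exp (ℓ / 2) := by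
      rw [← Real.exp_add]; ring_nf
    rw [hL, h2]; nlinarith [Real.exp_pos (ℓ / 2)]
  refine ⟨by linarith, ?_⟩
  have hkey : 2 ≤ 1 / 10 * L - (2 * B + 2) * ℓ := by nlinarith
  have h3 : 3 ≤ Real.exp (1 / 10 * L - (2 * B + 2) * ℓ) := by
    have := Real.add_one_le_exp (1 / 10 * L - (2 * B + 2) * ℓ); linarith
  have e : Real.exp (1 / 2 * L) = Real.exp (1 / 10 * L - (2 * B + 2) * ℓ) *
      (Real.exp ((B + 1) * ℓ) * Real.exp ((B + 1) * ℓ)) * Real.exp (2 / 5 * L) := by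
    rw [← Real.exp_add, ← Real.exp_add, ← Real.exp_add]; ring_nf
  rw [e]
  have h0 : 0 ≤ (Real.exp ((B + 1) * ℓ) * Real.exp ((B + 1) * ℓ)) * Real.exp (2 / 5 * L) := by
    positivity
  nlinarith

/-- The integer `N/k` is at least `E` as soon as `3DE ≤ X ≤ y`, `y − 1 ≤ N`, `k ≤ D`, `D, E ≥ 1`.
[folklore] -/
theorem le_natDiv_of_le {N k : ℕ} {E D X y : ℝ} (hk : 0 < k) (hkD : (k : ℝ) ≤ D) (hD1 : 1 ≤ D)
    (hE1 : 1 ≤ E) (hkey : 3 * D * E ≤ X) (hy : X ≤ y) (hyN : y - 1 ≤ N) :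
    E ≤ ((N / k : ℕ) : ℝ) := by
  have hk' : (0 : ℝ) < k := by exact_mod_cast hk
  -- `N/k − 1 ≤ ⌊N/k⌋` (the tree's `Lichtman2020.sub_one_le_natDiv`, inlined to keep the imports light)
  have hdiv : (N : ℝ) / k - 1 ≤ ((N / k : ℕ) : ℝ) := by
    have h := Nat.lt_div_mul_add (a := N) hk
    have h' : (N : ℝ) < ((N / k : ℕ) : ℝ) * k + k := by exact_mod_cast h
    rw [div_sub_one hk'.ne', div_le_iff₀ hk']; linarith
  refine le_trans ?_ hdiv
  rw [le_sub_iff_add_le, le_div_iff₀ hk']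
  have h1 : (E + 1) * (k : ℝ) ≤ (E + 1) * D := mul_le_mul_of_nonneg_left hkD (by linarith)
  have h2 : D ≤ D * E := le_mul_of_one_le_right (by linarith) hE1
  nlinarith

/-- Summation of the two regimes: `∑_{0 < r ≤ S} f(r) ≤ 2A + N/R₀` if `f(r) ≤ A/r²` for `r ≤ R₀`
and `f(r) ≤ N/r²` for `r > R₀` (`∑ 1/r² ≤ 2`, `∑_{r > R₀} 1/r² ≤ 1/R₀`). [folklore] -/
theorem sum_two_regimes_le {f : ℕ → ℝ} {S R₀ : ℕ} {A Nr : ℝ} (hR₀ : 1 ≤ R₀) (hA : 0 ≤ A)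
    (hNr : 0 ≤ Nr) (hsmall : ∀ r ∈ Ioc 0 S, r ≤ R₀ → f r ≤ A * (1 / (r : ℝ) ^ 2))
    (hlarge : ∀ r ∈ Ioc R₀ S, f r ≤ Nr * (1 / (r : ℝ) ^ 2)) :
    ∑ r ∈ Ioc 0 S, f r ≤ 2 * A + Nr * (1 / R₀) := by
  rw [← sum_filter_add_sum_filter_not (Ioc 0 S) (fun r ↦ r ≤ R₀)]
  have hfilt : (Ioc 0 S).filter (fun r ↦ ¬r ≤ R₀) = Ioc R₀ S := by
    ext r; simp only [mem_filter, mem_Ioc, not_le]; omega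
  rw [hfilt]
  refine add_le_add ?_ ?_
  · calc ∑ r ∈ (Ioc 0 S).filter (fun r ↦ r ≤ R₀), f r
        ≤ ∑ r ∈ (Ioc 0 S).filter (fun r ↦ r ≤ R₀), A * (1 / (r : ℝ) ^ 2) :=
          sum_le_sum fun r hr ↦ by rw [mem_filter] at hr; exact hsmall r hr.1 hr.2
      _ ≤ ∑ r ∈ Ioc 0 S, A * (1 / (r : ℝ) ^ 2) :=
          sum_le_sum_of_subset_of_nonneg (filter_subset _ _) fun _ _ _ ↦ by positivity
      _ = A * ∑ r ∈ Ioc 0 S, (1 / (r : ℝ) ^ 2) := by rw [mul_sum]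
      _ ≤ A * 2 := mul_le_mul_of_nonneg_left (SiegelWalfiszLiouville.sum_Ioc_inv_sq_le_two _) hA
      _ = 2 * A := by ring
  · calc ∑ r ∈ Ioc R₀ S, f r ≤ ∑ r ∈ Ioc R₀ S, Nr * (1 / (r : ℝ) ^ 2) := sum_le_sum hlarge
      _ = Nr * ∑ r ∈ Ioc R₀ S, (1 / (r : ℝ) ^ 2) := by rw [mul_sum]
      _ ≤ Nr * (1 / R₀) :=
          mul_le_mul_of_nonneg_left (SiegelWalfiszLiouville.sum_Ioc_inv_sq_le hR₀ _) hNr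

/-- **The non-principal case.** For `B ≥ 0` there is `x₂` such that for `x ≥ x₂`, `q ≤ x^{1/16}`,
`χ ≠ χ₀` mod `q` with no zero of `L(s, χ)` in `1 − (200(B+1)+1000) log log x/log x < Re s < 1`,
`|Im s| ≤ (log x)^{3(B+1)+12}`, and `x^{1/2} ≤ y ≤ x²`: `‖∑_{k ≤ y} λ(k)χ(k)‖ ≤ y/(log x)^B`.
[cite: IwaniecKowalski2004, §18.2] -/
theorem norm_sum_le_of_ne_one {B : ℝ} (hB : 0 ≤ B) :
    ∃ x₂ : ℝ, ∀ x : ℝ, x₂ ≤ x → ∀ (q : ℕ) [NeZero q], (q : ℝ) ≤ x ^ (1 / 16 : ℝ) →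
      ∀ χ : DirichletCharacter ℂ q, χ ≠ 1 →
        (∀ z : ℂ, 1 - (200 * (B + 1) + 1000) * Real.log (Real.log x) / Real.log x < z.re →
          |z.im| ≤ Real.log x ^ (3 * (B + 1) + 12) → z.re < 1 → χ.LFunction z ≠ 0) →
        ∀ y : ℝ, x ^ (1 / 2 : ℝ) ≤ y → y ≤ x ^ 2 →
          ‖∑ k ∈ Icc 1 ⌊y⌋₊, (liouville k : ℂ) * χ (k : ZMod q)‖ ≤ y / Real.log x ^ B := by
  obtain ⟨x₃, hx₃⟩ := MoebiusCharSumLinnikBox.norm_sum_le (B := B + 1) (by linarith)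
  refine ⟨max x₃ (Real.exp (Real.exp (80 * B + 100))), fun x hx q _ hq χ hχ hbox y hy1 hy2 ↦ ?_⟩
  have hx3 : x₃ ≤ x := (le_max_left _ _).trans hx
  have hx4 : Real.exp (Real.exp (80 * B + 100)) ≤ x := (le_max_right _ _).trans hx
  have hx0 : 0 < x := (Real.exp_pos _).trans_le hx4
  obtain ⟨L, hLdef⟩ : ∃ L : ℝ, L = Real.log x := ⟨_, rfl⟩
  have hLℓ : Real.exp (80 * B + 100) ≤ L := by
    rw [hLdef, ← Real.log_exp (Real.exp _)]; exact Real.log_le_log (Real.exp_pos _) hx4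
  have hL0 : 0 < L := (Real.exp_pos _).trans_le hLℓ
  obtain ⟨ℓ, hℓdef⟩ : ∃ ℓ : ℝ, ℓ = Real.log L := ⟨_, rfl⟩
  have hℓ : 80 * B + 100 ≤ ℓ := by
    rw [hℓdef, ← Real.log_exp (80 * B + 100)]; exact Real.log_le_log (Real.exp_pos _) hLℓ
  have hℓ0 : 0 ≤ ℓ := by linarith only [hℓ, hB]
  have hLexp : L = Real.exp ℓ := by rw [hℓdef, Real.exp_log hL0]
  obtain ⟨hL16, hkey⟩ := numerics₂ hB hℓ hLexp
  have hM : ∀ n : ℕ, x ^ (2 / 5 : ℝ) ≤ n → (n : ℝ) ≤ x ^ 2 →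
      ‖∑ m ∈ Icc 1 n, χ (m : ZMod q) * (μ m : ℂ)‖ ≤ n / L ^ (B + 1) := by
    intro n h1 h2; rw [hLdef]; exact hx₃ x hx3 q hq χ hχ hbox n h1 h2
  -- `N = ⌊y⌋`, the splitting point `R₀ = ⌊L^{B+1}⌋`, `D = L^{B+1} ⋅ L^{B+1}`
  set N := ⌊y⌋₊ with hN
  have hy0 : 0 < y := (Real.rpow_pos_of_pos hx0 _).trans_le hy1
  have hNy : (N : ℝ) ≤ y := Nat.floor_le hy0.le
  have hyN : y - 1 ≤ N := by
    have := Nat.lt_floor_add_one y; rw [← hN] at this; linarith only [this]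
  have hN0 : (0 : ℝ) ≤ N := Nat.cast_nonneg N
  have hLB : L ^ (B + 1) = Real.exp ((B + 1) * ℓ) := by
    rw [Real.rpow_def_of_pos hL0, ← hℓdef, mul_comm]
  have hLB1 : L ≤ L ^ (B + 1) := by
    rw [hLB, hLexp]; exact Real.exp_le_exp.2 (by nlinarith only [hB, hℓ0])
  have hLBp : 0 < L ^ (B + 1) := by linarith only [hLB1, hL0]
  obtain ⟨R₀, hR₀⟩ : ∃ R₀ : ℕ, R₀ = ⌊L ^ (B + 1)⌋₊ := ⟨_, rfl⟩
  have hR₀le : (R₀ : ℝ) ≤ L ^ (B + 1) := by rw [hR₀]; exact Nat.floor_le hLBp.le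
  have hR₀ge : L ^ (B + 1) / 2 ≤ R₀ := by
    have := Nat.lt_floor_add_one (L ^ (B + 1)); rw [← hR₀] at this
    linarith only [this, hLB1, hL16]
  have hR₀1r : (1 : ℝ) ≤ R₀ := by linarith only [hR₀ge, hLB1, hL16]
  have hR₀1 : 1 ≤ R₀ := by exact_mod_cast hR₀1r
  -- conversions to exponentials
  have e1 : x ^ (2 / 5 : ℝ) = Real.exp (2 / 5 * L) := by
    rw [Real.rpow_def_of_pos hx0, hLdef]; ring_nf
  have e3 : x ^ (1 / 2 : ℝ) = Real.exp (1 / 2 * L) := by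
    rw [Real.rpow_def_of_pos hx0, hLdef]; ring_nf
  have hE1 : 1 ≤ Real.exp (2 / 5 * L) := Real.one_le_exp (by linarith only [hL0])
  have hD1 : 1 ≤ Real.exp ((B + 1) * ℓ) * Real.exp ((B + 1) * ℓ) := by
    rw [← hLB]; nlinarith only [hLB1, hL16]
  rw [e3] at hy1
  -- the Möbius sums at `N/r²`
  have hsmall : ∀ r ∈ Ioc 0 (Nat.sqrt N), r ≤ R₀ →
      ‖∑ m ∈ Icc 1 (N / (r * r)), χ (m : ZMod q) * (μ m : ℂ)‖ ≤
        N / L ^ (B + 1) * (1 / (r : ℝ) ^ 2) := by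
    intro r hr hrR
    rw [mem_Ioc] at hr
    have hr0 : 0 < r := hr.1
    have hr0' : (0 : ℝ) < r := by exact_mod_cast hr0
    have hrR' : (r : ℝ) ≤ L ^ (B + 1) := le_trans (by exact_mod_cast hrR) hR₀le
    have hrr : ((r * r : ℕ) : ℝ) ≤ Real.exp ((B + 1) * ℓ) * Real.exp ((B + 1) * ℓ) := by
      push_cast; rw [← hLB]; exact mul_le_mul hrR' hrR' hr0'.le hLBp.le
    have hlow : x ^ (2 / 5 : ℝ) ≤ ((N / (r * r) : ℕ) : ℝ) := by
      rw [e1]; exact le_natDiv_of_le (Nat.mul_pos hr0 hr0) hrr hD1 hE1 hkey hy1 hyN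
    have hup : ((N / (r * r) : ℕ) : ℝ) ≤ x ^ 2 :=
      le_trans (by exact_mod_cast Nat.div_le_self _ _) (hNy.trans hy2)
    refine (hM _ hlow hup).trans ?_
    have hdiv : ((N / (r * r) : ℕ) : ℝ) ≤ N * (1 / (r : ℝ) ^ 2) := by
      refine (Nat.cast_div_le).trans (le_of_eq ?_); push_cast; ring
    rw [div_le_iff₀ hLBp]
    calc ((N / (r * r) : ℕ) : ℝ) ≤ N * (1 / (r : ℝ) ^ 2) := hdiv
      _ = N / L ^ (B + 1) * (1 / (r : ℝ) ^ 2) * L ^ (B + 1) := by field_simp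
  have hlarge : ∀ r ∈ Ioc R₀ (Nat.sqrt N),
      ‖∑ m ∈ Icc 1 (N / (r * r)), χ (m : ZMod q) * (μ m : ℂ)‖ ≤ N * (1 / (r : ℝ) ^ 2) := by
    intro r _
    refine (norm_moebius_twist_sum_le χ _).trans ?_
    refine (Nat.cast_div_le).trans (le_of_eq ?_); push_cast; ring
  have hsum := sum_two_regimes_le hR₀1 (by positivity) hN0 hsmall hlarge
  refine (norm_sum_liouville_twist_le χ N).trans (hsum.trans ?_)
  -- `2N/L^{B+1} + N/R₀ ≤ 4 N/L^{B+1} ≤ y/L^B`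
  have h1 : (N : ℝ) * (1 / R₀) ≤ 2 * (N / L ^ (B + 1)) := by
    rw [show 2 * (N / L ^ (B + 1)) = N * (2 / L ^ (B + 1)) by ring]
    refine mul_le_mul_of_nonneg_left ?_ hN0
    rw [div_le_div_iff₀ (by linarith only [hR₀1r]) hLBp]; linarith only [hR₀ge]
  refine (add_le_add le_rfl h1).trans ?_
  rw [← hLdef]
  have hLB' : L ^ (B + 1) = L ^ B * L := by rw [Real.rpow_add hL0, Real.rpow_one]
  have hLBp' : 0 < L ^ B := Real.rpow_pos_of_pos hL0 B
  rw [hLB', le_div_iff₀ hLBp']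
  have e : (2 * (N / (L ^ B * L)) + 2 * (N / (L ^ B * L))) * L ^ B = 4 * N / L := by
    field_simp; ring
  rw [e, div_le_iff₀ hL0]
  nlinarith only [hNy, hL16, hN0]

/-! ### All characters -/

/-- For the principal character the twisted sum is the sum over `k` coprime to `q`. [folklore] -/
theorem sum_liouville_one_eq (q N : ℕ) :
    ∑ k ∈ Icc 1 N, (liouville k : ℂ) * (1 : DirichletCharacter ℂ q) (k : ZMod q) =
      ((∑ k ∈ (Icc 1 N).filter (fun k ↦ k.Coprime q), (liouville k : ℝ) : ℝ) : ℂ) := by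
  rw [sum_filter, Complex.ofReal_sum]
  refine sum_congr rfl fun k _ ↦ ?_
  by_cases hk : k.Coprime q
  · rw [MulChar.one_apply ((ZMod.isUnit_iff_coprime k q).2 hk), if_pos hk, mul_one,
      Complex.ofReal_intCast]
  · rw [MulChar.map_nonunit _ (fun h ↦ hk ((ZMod.isUnit_iff_coprime k q).1 h)), if_neg hk,
      mul_zero, Complex.ofReal_zero]

/-- **Character sums of `λ` from a zero-free Linnik box (all characters).** For every real `B`
there are `K', H, x₀` such that for `x ≥ x₀`, `q ≤ x^{1/16}`, every character `χ` mod `q` with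
`L(s, χ) ≠ 0` for `s ≠ 1`, `Re s > 1 − K' log log x/log x`, `|Im s| ≤ (log x)^H`, and every
`x^{1/2} ≤ y ≤ x²`: `‖∑_{k ≤ y} λ(k)χ(k)‖ ≤ y/(log x)^B`. [cite: IwaniecKowalski2004, §18.2] -/
theorem norm_sum_le (B : ℝ) :
    ∃ K' H x₀ : ℝ, ∀ x : ℝ, x₀ ≤ x → ∀ (q : ℕ) [NeZero q], (q : ℝ) ≤ x ^ (1 / 16 : ℝ) →
      ∀ χ : DirichletCharacter ℂ q,
        (∀ z : ℂ, 1 - K' * Real.log (Real.log x) / Real.log x < z.re →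
          |z.im| ≤ Real.log x ^ H → z ≠ 1 → χ.LFunction z ≠ 0) →
        ∀ y : ℝ, x ^ (1 / 2 : ℝ) ≤ y → y ≤ x ^ 2 →
          ‖∑ k ∈ Icc 1 ⌊y⌋₊, (liouville k : ℂ) * χ (k : ZMod q)‖ ≤ y / Real.log x ^ B := by
  have hB'0 : 0 ≤ max B 0 := le_max_right _ _
  obtain ⟨x₂, hx₂⟩ := norm_sum_le_of_ne_one hB'0
  obtain ⟨x₁, hx₁⟩ := LiouvilleCoprimeSum.abs_sum_liouville_coprime_le hB'0
  refine ⟨200 * (max B 0 + 1) + 1000, 3 * (max B 0 + 1) + 12, max (max x₁ x₂) (Real.exp (Real.exp 1)),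
    fun x hx q _ hq χ hbox y hy1 hy2 ↦ ?_⟩
  have hx1 : x₁ ≤ x := ((le_max_left _ _).trans (le_max_left _ _)).trans hx
  have hx2 : x₂ ≤ x := ((le_max_right _ _).trans (le_max_left _ _)).trans hx
  have hxe : Real.exp (Real.exp 1) ≤ x := (le_max_right _ _).trans hx
  have hx0 : 0 < x := (Real.exp_pos _).trans_le hxe
  have hL1 : 1 ≤ Real.log x := by
    have h : Real.exp 1 ≤ Real.log x := by
      rw [← Real.log_exp (Real.exp 1)]; exact Real.log_le_log (Real.exp_pos _) hxe
    linarith [Real.add_one_le_exp (1 : ℝ)]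
  have hy0 : 0 < y := (Real.rpow_pos_of_pos hx0 _).trans_le hy1
  have hweak : y / Real.log x ^ max B 0 ≤ y / Real.log x ^ B :=
    div_le_div_of_nonneg_left hy0.le (Real.rpow_pos_of_pos (by linarith) _)
      (Real.rpow_le_rpow_of_exponent_le hL1 (le_max_left _ _))
  by_cases hχ : χ = 1
  · subst hχ
    rw [sum_liouville_one_eq, Complex.norm_real, Real.norm_eq_abs]
    exact (hx₁ x hx1 q (NeZero.pos q) hq y hy1 hy2).trans hweak
  · refine le_trans (hx₂ x hx2 q hq χ hχ (fun z h1 h2 h3 ↦ hbox z h1 h2 ?_) y hy1 hy2) hweak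
    intro h; rw [h, Complex.one_re] at h3; exact lt_irrefl _ h3

end LiouvilleCharSumLinnikBox

end Literature.NumberTheory.LFunctions

end
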